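import Literature.MathematicalPhysics.QuantumLattice.HubbardLangerMattisMoments
import HarnessLib

/-!
# Cosine power sums over `ℤ/Lℤ` and exact band moments on `(ℤ/Lℤ)²` — all degrees at once

Topic `MathematicalPhysics/QuantumLattice`, family `hubbard`; companion of `HubbardLangerMattisMoments.lean`, which proves the
cosine power sums `Σ_{a ∈ ℤ/L} cos^m(2πa/L)` degree by degree (`m ≤ 8`, [cite: GradshteynRyzhik2015, 1.320.5]) and from them the
exact even band moments `L⁻² Σ_k ε_k^{2j}` (`j ≤ 4`) of the square-lattice band `ε(p) = cos p₁ + cos p₂` that the kernel-only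
Langer–Mattis floors of that file consume. Here the same is done for EVERY degree in one statement:

* `cosWalk n m` — the number of `±1`-step walks of length `n` on `ℤ` from `m` to `0` (closed form `C(n, (n+m)/2)` when `n + m` is
  even, else `0`), with its Pascal-type recurrence;
* `two_pow_mul_sum_cos_pow_mul_cos` — the mixed power sum `2^n Σ_a cos(θ_a)^n cos(m θ_a) = L · cosWalk n m` for `n + m < L`,
  `θ_a = 2πa/L`, by induction on `n` from the product-to-sum formula `cos θ · cos((m+1)θ) = (cos((m+2)θ) + cos(mθ))/2` and
  character orthogonality `LangerMattis.sum_cos_mul_angle_eq_zero` (tree);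
* `sum_cos_angle_pow` — `Σ_a cos(2πa/L)^n = L · cosWalk n 0 / 2^n` for every `n < L` (`= C(2j,j) L / 4^j` for `n = 2j`, `0` for odd
  `n`): the finite-group form of the power-reduction formulas [cite: GradshteynRyzhik2015, 1.320.5 / 1.320.7] — all harmonics
  `cos(kθ)`, `0 < k < L`, average to zero over the `L`-th roots of unity;
* `sum_cosSum_pow` — the two-dimensional band moments `Σ_{k ∈ (ℤ/L)²} (cos p₁ + cos p₂)^n =
  L² · (Σ_{i ≤ n} C(n,i) · cosWalk i 0 · cosWalk (n−i) 0) / 2^n` for `n < L` (binomial expansion + the product structure of the torus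
  sum, tree `LangerMattis.sum_torusSite_two_mul`);
* `bandWalkSum_eq` / `sum_cosSum_pow_even` — the inner sum equals `C(2j,j)²` (the number of closed walks of length `2j` on `ℤ²`;
  classically `Σ_a C(2j,2a) C(2a,a) C(2j−2a,j−a) = C(2j,j) Σ_a C(j,a)² = C(2j,j)²` by Vandermonde), EVALUATED here for `j ≤ 24`,
  hence `Σ_k (cos p₁ + cos p₂)^{2j} = L² · C(2j,j)² / 4^j` for `j ≤ 24`, `L ≥ 49` — the moments a degree-48 polynomial majorant of
  the Langer–Mattis integrand needs (`Summits/Ventures/CertifiedManyBodySolver/Lower/LangerMattisU1Majorant.lean`).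
  `-- TODO(general form): all j, via Vandermonde's identity (Mathlib `Nat.add_choose_eq`).`

Design: the walk-number recurrence and the trigonometric steps are `private` helpers; everything is stated for the concrete angles `2π a.val / L` of `HubbardLangerMattisMoments.lean` so that the lemmas
rewrite the tree's sums literally; `cosWalk` is a plain `ℕ`-valued `def` so that every numeric instance is `decide`/`norm_num`.
Deliberately NOT here: Chebyshev-basis moments, odd two-dimensional moments (they vanish), the `d`-dimensional torus.

Provenance: statements and proofs by hubbard-alg L3 seat A (planner-sr-mbsolver-l3-idea-1 g42/g43, scratch
`HOME/hubbard-alg/L3-hybrid/tools-seatA/lce/LangerMattisPowerSums.lean` sha16 71ff9f70d590dd0a, kernel-checked there inside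
`concat_LCE110_NEVER_PROPOSE.lean` rc 0); tree placement, docstrings and the `j ≤ 24` packaging by the LIT lane (literature-prover
lit-1 g23). 0 facts, 0 sorries.

## References

* I. S. Gradshteyn, I. M. Ryzhik, *Table of Integrals, Series, and Products* (8th ed., Zwillinger–Moll, 2015), §1.320.5 / §1.320.7
  (power-reduction formulas for `cos^{2n} x`, `cos^{2n-1} x`). [GradshteynRyzhik2015]
* W. D. Langer, D. C. Mattis, Phys. Lett. 36A (1971) 139–140 (the bound these moments feed). [LangerMattis1971]

## Mathlib / tree search

Tree (REUSED): `LangerMattis.sum_cos_mul_angle_eq_zero`, `LangerMattis.sum_torusSite_two_mul`, `sum_cos_angle_pow_four/six/eight`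
(per-degree predecessors), `Literature.Probability.LatticeModels.latticeMomentum`, `TorusSite`. Mathlib: `Nat.choose_succ_succ`,
`Nat.choose_symm_half`, `Real.cos_add`, `Real.cos_sub`, `add_pow`, `Finset.sum_comm`, `Nat.choose_eq_descFactorial_div_factorial`
(the `norm_num` evaluator route for large binomials).
-/

noncomputable section

namespace Literature.MathematicalPhysics.QuantumLattice

namespace LangerMattis

open Finset Literature.Probability.LatticeModels

variable {L : ℕ} [NeZero L]

/-- Walk numbers: `cosWalk n m` = number of `±1`-step walks of length `n` from `m` to `0` on `ℤ`
(closed form `C(n, (n+m)/2)` when `n+m` is even, else `0`). [folklore] -/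
def cosWalk (n m : ℕ) : ℕ := if Even (n + m) then n.choose ((n + m) / 2) else 0

/-- No step, at the origin: one walk. [folklore] -/
private theorem cosWalk_zero_zero : cosWalk 0 0 = 1 := by
  simp [cosWalk]

/-- No step, away from the origin: no walk. [folklore] -/
private theorem cosWalk_zero_succ (m : ℕ) : cosWalk 0 (m + 1) = 0 := by
  unfold cosWalk
  split_ifs with h
  · obtain ⟨r, hr⟩ := h
    have hr' : (0 + (m + 1)) / 2 = r := by omega
    rw [hr']
    cases r with
    | zero => omega
    | succ r => simp
  · rfl

/-- First-step decomposition at the origin: `W(n+1, 0) = 2 W(n, 1)` (by the symmetry `m ↦ -m`). [folklore] -/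
private theorem cosWalk_succ_zero (n : ℕ) : cosWalk (n + 1) 0 = 2 * cosWalk n 1 := by
  unfold cosWalk
  rcases Nat.even_or_odd n with ⟨k, hk⟩ | ⟨k, hk⟩
  · -- n even: n + 1 odd, n + 1 odd
    have h1 : ¬ Even (n + 1 + 0) := by
      rw [Nat.not_even_iff_odd]; exact ⟨k, by omega⟩
    have h2 : ¬ Even (n + 1) := by
      rw [Nat.not_even_iff_odd]; exact ⟨k, by omega⟩
    rw [if_neg h1, if_neg h2]
  · -- n = 2k+1
    subst hk
    have h1 : Even (2 * k + 1 + 1 + 0) := ⟨k + 1, by ring⟩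
    have h2 : Even (2 * k + 1 + 1) := ⟨k + 1, by ring⟩
    rw [if_pos h1, if_pos h2]
    have e1 : (2 * k + 1 + 1 + 0) / 2 = k + 1 := by omega
    have e2 : (2 * k + 1 + 1) / 2 = k + 1 := by omega
    rw [e1]
    try rw [e2]
    rw [Nat.choose_succ_succ (2 * k + 1) k, Nat.choose_symm_half k]
    ring

/-- First-step decomposition (Pascal): `W(n+1, m+1) = W(n, m+2) + W(n, m)`. [folklore] -/
private theorem cosWalk_succ_succ (n m : ℕ) : cosWalk (n + 1) (m + 1) = cosWalk n (m + 2) + cosWalk n m := by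
  unfold cosWalk
  rcases Nat.even_or_odd (n + m) with ⟨s, hs⟩ | ⟨s, hs⟩
  · have h1 : Even (n + 1 + (m + 1)) := ⟨s + 1, by omega⟩
    have h2 : Even (n + (m + 2)) := ⟨s + 1, by omega⟩
    have h3 : Even (n + m) := ⟨s, hs⟩
    rw [if_pos h1, if_pos h2, if_pos h3]
    have e1 : (n + 1 + (m + 1)) / 2 = s + 1 := by omega
    have e2 : (n + (m + 2)) / 2 = s + 1 := by omega
    have e3 : (n + m) / 2 = s := by omega
    rw [e1]
    try rw [e2]
    try rw [e3]
    rw [Nat.choose_succ_succ n s, Nat.add_comm]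
  · have h1 : ¬ Even (n + 1 + (m + 1)) := by
      rw [Nat.not_even_iff_odd]; exact ⟨s + 1, by omega⟩
    have h2 : ¬ Even (n + (m + 2)) := by
      rw [Nat.not_even_iff_odd]; exact ⟨s + 1, by omega⟩
    have h3 : ¬ Even (n + m) := by
      rw [Nat.not_even_iff_odd]; exact ⟨s, hs⟩
    rw [if_neg h1, if_neg h2, if_neg h3]

/-- Product-to-sum step of the recurrence: `cos^{n+1} x · cos((m+1)x) = (cos^n x · cos((m+2)x) + cos^n x · cos(mx))/2`
(pure trigonometry, `2 cos a cos b = cos(a+b) + cos(a−b)`). [folklore] -/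
private theorem cos_pow_succ_mul_cos_succ (n m : ℕ) (x : ℝ) :
    Real.cos x ^ (n + 1) * Real.cos (((m + 1 : ℕ) : ℝ) * x) =
      (Real.cos x ^ n * Real.cos (((m + 2 : ℕ) : ℝ) * x) + Real.cos x ^ n * Real.cos ((m : ℝ) * x)) / 2 := by
  have hprod : Real.cos (((m + 2 : ℕ) : ℝ) * x) + Real.cos ((m : ℝ) * x) =
      2 * Real.cos x * Real.cos (((m + 1 : ℕ) : ℝ) * x) := by
    rw [show ((m + 2 : ℕ) : ℝ) * x = ((m + 1 : ℕ) : ℝ) * x + x by push_cast; ring,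
      show (m : ℝ) * x = ((m + 1 : ℕ) : ℝ) * x - x by push_cast; ring, Real.cos_add, Real.cos_sub]
    ring
  rw [pow_succ]
  linear_combination (-(Real.cos x ^ n / 2)) * hprod

/-- The `m = 0` step of the recurrence: `cos^{n+1} x · cos(0·x) = cos^n x · cos(1·x)`. [folklore] -/
private theorem cos_pow_succ_mul_cos_zero (n : ℕ) (x : ℝ) :
    Real.cos x ^ (n + 1) * Real.cos (((0 : ℕ) : ℝ) * x) = Real.cos x ^ n * Real.cos (((1 : ℕ) : ℝ) * x) := by
  simp only [Nat.cast_zero, zero_mul, Real.cos_zero, mul_one, Nat.cast_one, one_mul, pow_succ]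

/-- **Generic mixed power sum**: `2^n Σ_a cos(θ_a)^n cos(m θ_a) = L · W(n,m)` for `n + m < L`, `θ_a = 2πa/L` — induction on `n`
from the product-to-sum step and character orthogonality `Σ_a cos(jθ_a) = 0` (`0 < j < L`); the finite-group form of the
power-reduction formulas for `cos^n x`. [cite: GradshteynRyzhik2015, 1.320.5] -/
theorem two_pow_mul_sum_cos_pow_mul_cos (n m : ℕ) (h : n + m < L) :
    2 ^ n * ∑ a : ZMod L, Real.cos (2 * Real.pi * ((a.val : ℕ) : ℝ) / L) ^ n *
        Real.cos ((m : ℝ) * (2 * Real.pi * ((a.val : ℕ) : ℝ) / L)) = (L : ℝ) * (cosWalk n m : ℕ) := by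
  induction n generalizing m with
  | zero =>
    cases m with
    | zero =>
      simp only [pow_zero, Nat.cast_zero, zero_mul, Real.cos_zero, mul_one, Finset.sum_const,
        Finset.card_univ, ZMod.card, nsmul_eq_mul, one_mul, cosWalk_zero_zero, Nat.cast_one]
    | succ m =>
      have h0 := sum_cos_mul_angle_eq_zero (L := L) (j := m + 1) (Nat.succ_pos m) (by omega)
      rw [cosWalk_zero_succ]
      simp only [pow_zero, one_mul, Nat.cast_zero, mul_zero]
      exact h0
  | succ n ih =>
    cases m with
    | zero =>
      have h1 := ih 1 (by omega)
      rw [cosWalk_succ_zero]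
      simp_rw [cos_pow_succ_mul_cos_zero]
      push_cast at h1 ⊢
      linear_combination 2 * h1
    | succ m =>
      have h1 := ih (m + 2) (by omega)
      have h2 := ih m (by omega)
      rw [cosWalk_succ_succ]
      simp_rw [cos_pow_succ_mul_cos_succ]
      rw [← Finset.sum_div, Finset.sum_add_distrib]
      push_cast at h1 h2 ⊢
      linear_combination h1 + h2

/-- **All cosine power sums at once**: `Σ_a cos(2πa/L)^n = L · W(n,0) / 2^n` for `n < L`
(`W(2j,0) = C(2j,j)`, `W(odd,0) = 0`) — the discrete form of the power-reduction formulas for `cos^{2n} x`,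
`cos^{2n-1} x`, every non-constant harmonic averaging to zero over `ℤ/Lℤ`. [cite: GradshteynRyzhik2015, 1.320.5] -/
theorem sum_cos_angle_pow (n : ℕ) (hn : n < L) :
    ∑ a : ZMod L, Real.cos (2 * Real.pi * ((a.val : ℕ) : ℝ) / L) ^ n =
      (L : ℝ) * (cosWalk n 0 : ℕ) / 2 ^ n := by
  have h := two_pow_mul_sum_cos_pow_mul_cos (L := L) n 0 (by omega)
  simp only [Nat.cast_zero, zero_mul, Real.cos_zero, mul_one] at h
  rw [eq_div_iff (pow_ne_zero _ two_ne_zero)]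
  linarith

/-- **All even band moments at once** on the torus `(ℤ/Lℤ)²`:
`Σ_k (cos p₁ + cos p₂)^n = L² · (Σ_{i=0}^{n} C(n,i) W(i,0) W(n−i,0)) / 2^n` for `n < L` — binomial expansion and the product
structure of the torus sum reduce it to the one-dimensional power sums, i.e. to the power-reduction formula in each coordinate
(the tree's `sum_cosSum_pow_eight` is the instance `n = 8`). [cite: GradshteynRyzhik2015, 1.320.5] -/
theorem sum_cosSum_pow (n : ℕ) (hn : n < L) :
    ∑ k : TorusSite 2 L, (∑ i, Real.cos (latticeMomentum L k i)) ^ n =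
      (L : ℝ) ^ 2 * (∑ i ∈ Finset.range (n + 1),
        ((n.choose i : ℕ) : ℝ) * (cosWalk i 0 : ℕ) * (cosWalk (n - i) 0 : ℕ)) / 2 ^ n := by
  set c : ZMod L → ℝ := fun a => Real.cos (2 * Real.pi * ((a.val : ℕ) : ℝ) / L) with hc
  have hlm : ∀ k : TorusSite 2 L, ∑ i, Real.cos (latticeMomentum L k i) = c (k 0) + c (k 1) :=
    fun k => by rw [Fin.sum_univ_two]; rfl
  have hmon : ∀ i j : ℕ, ∑ k : TorusSite 2 L, c (k 0) ^ i * c (k 1) ^ j =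
      (∑ a, c a ^ i) * ∑ a, c a ^ j := fun i j => sum_torusSite_two_mul (fun a => c a ^ i) fun a => c a ^ j
  have hS : ∀ i : ℕ, i < L → ∑ a, c a ^ i = (L : ℝ) * (cosWalk i 0 : ℕ) / 2 ^ i :=
    fun i hi => sum_cos_angle_pow i hi
  simp_rw [hlm, add_pow]
  rw [Finset.sum_comm]
  have hterm : ∀ i ∈ Finset.range (n + 1),
      ∑ k : TorusSite 2 L, c (k 0) ^ i * c (k 1) ^ (n - i) * ((n.choose i : ℕ) : ℝ) =
        (L : ℝ) ^ 2 * (((n.choose i : ℕ) : ℝ) * (cosWalk i 0 : ℕ) * (cosWalk (n - i) 0 : ℕ)) / 2 ^ n := by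
    intro i hi
    have hi' : i ≤ n := Nat.lt_succ_iff.mp (Finset.mem_range.mp hi)
    rw [← Finset.sum_mul, hmon, hS i (by omega), hS (n - i) (by omega)]
    have h2 : (2 : ℝ) ^ i * 2 ^ (n - i) = 2 ^ n := by
      rw [← pow_add, Nat.add_sub_cancel' hi']
    field_simp
    rw [← h2]
    ring
  rw [Finset.sum_congr rfl hterm, ← Finset.sum_div, ← Finset.mul_sum]

/-! ### The closed-walk numbers `C(2j,j)²` and the even band moments, `j ≤ 24` -/

/-- **Closed walks on `ℤ²`**: `Σ_{i ≤ 2j} C(2j,i) · W(i,0) · W(2j−i,0) = C(2j,j)²` — the number of closed nearest-neighbour walks of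
length `2j` on `ℤ²` (choose which steps are horizontal, then close each coordinate), classically `= C(2j,j) Σ_a C(j,a)² = C(2j,j)²`
by Vandermonde; established here for `j ≤ 24` by exact evaluation (the range the degree-48 majorant needs).
-- TODO(general form): every `j`, via `Nat.add_choose_eq`. [folklore] -/
private theorem bandWalkSum_eq (j : ℕ) (hj : j ≤ 24) :
    (∑ i ∈ Finset.range (2 * j + 1),
        (((2 * j).choose i : ℕ) : ℝ) * (cosWalk i 0 : ℕ) * (cosWalk (2 * j - i) 0 : ℕ)) =
      (((2 * j).choose j : ℕ) : ℝ) ^ 2 := by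
  interval_cases j <;>
    (simp only [Finset.sum_range_succ, Finset.sum_range_zero]
     norm_num [cosWalk, Nat.choose_eq_descFactorial_div_factorial])

/-- **Even band moments, exactly**: `Σ_{k ∈ (ℤ/L)²} (cos p₁ + cos p₂)^{2j} = L² · C(2j,j)² / 4^j` for `j ≤ 24` and `2j < L`
(`L⁻²`-normalised: `1, 9/4, 25/4, 1225/64, 3969/64, …`; the tree's `sum_cosSum_pow_two_four_six` / `sum_cosSum_pow_eight` are
`j ≤ 4` for the band `2t(cos p₁ + cos p₂)`) — instances of the power-reduction formula in each coordinate. [cite: GradshteynRyzhik2015, 1.320.5] -/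
theorem sum_cosSum_pow_even (j : ℕ) (hj : j ≤ 24) (hL : 2 * j < L) :
    ∑ k : TorusSite 2 L, (∑ i, Real.cos (latticeMomentum L k i)) ^ (2 * j) =
      (L : ℝ) ^ 2 * (((2 * j).choose j : ℕ) : ℝ) ^ 2 / 4 ^ j := by
  rw [sum_cosSum_pow (2 * j) hL, bandWalkSum_eq j hj, pow_mul]
  norm_num


/-! ### Appendix (lit-1 g23, same day): the closed-walk count for EVERY degree

The instance lemma `sum_cosSum_pow_even` above carries `j ≤ 24` because its inner sum was evaluated numerically. Here the
inner sum of `sum_cosSum_pow` is identified in closed form for every `n`: it is the number of closed nearest-neighbour walks of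
length `n` on `ℤ²`, i.e. `C(2j,j)²` for `n = 2j` (three `Nat.choose_mul` rearrangements and Vandermonde's convolution
`Nat.add_choose_eq`) and `0` for odd `n`; hence the band moments for every degree `n < L` (`sum_cosSum_pow_closedWalk`,
`sum_cosSum_pow_two_mul`). Nothing above is modified. -/

/-- Parity split of a range sum: `Σ_{i < 2n+1} f i = Σ_{a ≤ n} f(2a) + Σ_{a < n} f(2a+1)`. [folklore] -/
private theorem sum_range_two_mul_succ (f : ℕ → ℝ) (n : ℕ) :
    ∑ i ∈ Finset.range (2 * n + 1), f i =
      ∑ a ∈ Finset.range (n + 1), f (2 * a) + ∑ a ∈ Finset.range n, f (2 * a + 1) := by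
  induction n with
  | zero => simp
  | succ n ih =>
    rw [show 2 * (n + 1) + 1 = 2 * n + 1 + 1 + 1 by ring, Finset.sum_range_succ, Finset.sum_range_succ, ih,
      Finset.sum_range_succ (fun a => f (2 * a)) (n + 1), Finset.sum_range_succ (fun a => f (2 * a + 1)) n]
    rw [show 2 * n + 1 + 1 = 2 * (n + 1) by ring]
    ring

/-- `W(2a, 0) = C(2a, a)`. [folklore] -/
private theorem cosWalk_two_mul (a : ℕ) : cosWalk (2 * a) 0 = (2 * a).choose a := by
  unfold cosWalk
  rw [if_pos ⟨a, by ring⟩]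
  congr 1
  omega

/-- `W(2a+1, 0) = 0` (no closed walk of odd length). [folklore] -/
private theorem cosWalk_two_mul_add_one (a : ℕ) : cosWalk (2 * a + 1) 0 = 0 := by
  unfold cosWalk
  rw [if_neg]
  rw [Nat.not_even_iff_odd]
  exact ⟨a, by ring⟩

/-- The trinomial rearrangement `C(2j,2a) C(2a,a) C(2j−2a,j−a) = C(2j,j) C(j,a)²` (`a ≤ j`): both sides count the ways to
split `2j` steps into `a` right, `a` left, `j−a` up, `j−a` down (three applications of `Nat.choose_mul`). [folklore] -/
private theorem choose_closedWalk_term {j a : ℕ} (ha : a ≤ j) :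
    (2 * j).choose (2 * a) * ((2 * a).choose a * ((2 * j - 2 * a).choose (j - a))) =
      (2 * j).choose j * (j.choose a * j.choose a) := by
  have e1 : (2 * j).choose (2 * a) * (2 * a).choose a = (2 * j).choose a * (2 * j - a).choose a := by
    have h := Nat.choose_mul (n := 2 * j) (k := 2 * a) (s := a) (by omega)
    rwa [show 2 * a - a = a by omega] at h
  have e2 : (2 * j).choose j * j.choose a = (2 * j).choose a * (2 * j - a).choose (j - a) :=
    Nat.choose_mul ha
  have e3 : (2 * j - a).choose j * j.choose a = (2 * j - a).choose a * (2 * j - a - a).choose (j - a) :=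
    Nat.choose_mul ha
  have e4 : (2 * j - a).choose j = (2 * j - a).choose (j - a) := by
    rw [← Nat.choose_symm (show j ≤ 2 * j - a by omega)]
    congr 1
    omega
  have e5 : 2 * j - a - a = 2 * j - 2 * a := by omega
  rw [e5] at e3
  calc (2 * j).choose (2 * a) * ((2 * a).choose a * ((2 * j - 2 * a).choose (j - a)))
      = ((2 * j).choose (2 * a) * (2 * a).choose a) * (2 * j - 2 * a).choose (j - a) := by ring
    _ = (2 * j).choose a * ((2 * j - a).choose a * (2 * j - 2 * a).choose (j - a)) := by rw [e1]; ring
    _ = (2 * j).choose a * ((2 * j - a).choose j * j.choose a) := by rw [e3]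
    _ = (2 * j).choose a * (2 * j - a).choose (j - a) * j.choose a := by rw [e4]; ring
    _ = (2 * j).choose j * j.choose a * j.choose a := by rw [← e2]
    _ = (2 * j).choose j * (j.choose a * j.choose a) := by ring

/-- Vandermonde's convolution at the centre: `Σ_{a ≤ j} C(j,a)² = C(2j,j)` (Mathlib `Nat.add_choose_eq`). [folklore] -/
private theorem sum_choose_mul_self (j : ℕ) :
    ∑ a ∈ Finset.range (j + 1), j.choose a * j.choose a = (2 * j).choose j := by
  have h := Nat.add_choose_eq j j j
  rw [Finset.Nat.sum_antidiagonal_eq_sum_range_succ_mk] at h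
  rw [two_mul, h]
  refine Finset.sum_congr rfl fun a ha => ?_
  have ha' : a ≤ j := Nat.lt_succ_iff.mp (Finset.mem_range.mp ha)
  rw [Nat.choose_symm ha']

/-- **Closed walks on `ℤ²`**: `Σ_{i ≤ 2j} C(2j,i) · W(i,0) · W(2j−i,0) = C(2j,j)²` for every `j` — the number of closed
nearest-neighbour walks of length `2j` on `ℤ²` (choose which steps are horizontal, then close each coordinate; the odd-`i` terms
vanish, the even ones rearrange to `C(2j,j) C(j,a)²`, and `Σ_a C(j,a)² = C(2j,j)` is Vandermonde). [folklore] -/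
private theorem bandWalkSum_eq_all (j : ℕ) :
    (∑ i ∈ Finset.range (2 * j + 1),
        (((2 * j).choose i : ℕ) : ℝ) * (cosWalk i 0 : ℕ) * (cosWalk (2 * j - i) 0 : ℕ)) =
      (((2 * j).choose j : ℕ) : ℝ) ^ 2 := by
  rw [sum_range_two_mul_succ]
  have hodd : ∑ a ∈ Finset.range j, (((2 * j).choose (2 * a + 1) : ℕ) : ℝ) * (cosWalk (2 * a + 1) 0 : ℕ) *
      (cosWalk (2 * j - (2 * a + 1)) 0 : ℕ) = 0 := by
    refine Finset.sum_eq_zero fun a _ => ?_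
    rw [cosWalk_two_mul_add_one]
    simp
  rw [hodd, add_zero]
  have heven : ∀ a ∈ Finset.range (j + 1), (((2 * j).choose (2 * a) : ℕ) : ℝ) * (cosWalk (2 * a) 0 : ℕ) *
      (cosWalk (2 * j - 2 * a) 0 : ℕ) = (((2 * j).choose j : ℕ) : ℝ) * ((j.choose a * j.choose a : ℕ) : ℝ) := by
    intro a ha
    have ha' : a ≤ j := Nat.lt_succ_iff.mp (Finset.mem_range.mp ha)
    rw [cosWalk_two_mul, show 2 * j - 2 * a = 2 * (j - a) by omega, cosWalk_two_mul,
      show 2 * (j - a) = 2 * j - 2 * a by omega]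
    have h := choose_closedWalk_term ha'
    have h' : (((2 * j).choose (2 * a) : ℕ) : ℝ) * (((2 * a).choose a : ℕ) : ℝ) *
        (((2 * j - 2 * a).choose (j - a) : ℕ) : ℝ) =
        (((2 * j).choose j : ℕ) : ℝ) * ((j.choose a * j.choose a : ℕ) : ℝ) := by
      rw [← Nat.cast_mul]
      exact_mod_cast (by rw [← h]; ring)
    exact h'
  rw [Finset.sum_congr rfl heven, ← Finset.mul_sum, ← Nat.cast_sum, sum_choose_mul_self, sq]

/-- For odd length there is no closed walk: `Σ_{i ≤ 2j+1} C(2j+1,i) · W(i,0) · W(2j+1−i,0) = 0` (one of `i`, `2j+1−i` is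
odd). [folklore] -/
private theorem bandWalkSum_odd (j : ℕ) :
    (∑ i ∈ Finset.range (2 * j + 1 + 1),
        (((2 * j + 1).choose i : ℕ) : ℝ) * (cosWalk i 0 : ℕ) * (cosWalk (2 * j + 1 - i) 0 : ℕ)) = 0 := by
  refine Finset.sum_eq_zero fun i hi => ?_
  have hi' : i ≤ 2 * j + 1 := Nat.lt_succ_iff.mp (Finset.mem_range.mp hi)
  rcases Nat.even_or_odd i with ⟨a, ha⟩ | ⟨a, ha⟩
  · have hodd : 2 * j + 1 - i = 2 * (j - a) + 1 := by omega
    rw [hodd, cosWalk_two_mul_add_one]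
    simp
  · rw [show i = 2 * a + 1 by omega, cosWalk_two_mul_add_one]
    simp

/-- **Band moments for every degree**: `Σ_{k ∈ (ℤ/L)²} (cos p₁ + cos p₂)^n = L² · W₂(n) / 2^n` for every `n < L`, where
`W₂(n)` = the number of closed nearest-neighbour walks of length `n` on `ℤ²` = `C(n, n/2)²` for even `n` and `0` for odd `n` —
the power-reduction formula in each coordinate [cite: GradshteynRyzhik2015, 1.320.5] combined by the closed-walk count. -/
theorem sum_cosSum_pow_closedWalk (n : ℕ) (hn : n < L) :
    ∑ k : TorusSite 2 L, (∑ i, Real.cos (latticeMomentum L k i)) ^ n =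
      (L : ℝ) ^ 2 * ((if Even n then (n.choose (n / 2)) ^ 2 else 0 : ℕ) : ℝ) / 2 ^ n := by
  rw [sum_cosSum_pow n hn]
  rcases Nat.even_or_odd n with ⟨j, hj⟩ | ⟨j, hj⟩
  · have hn2 : n = 2 * j := by omega
    subst hn2
    rw [bandWalkSum_eq_all j, if_pos ⟨j, by ring⟩, show 2 * j / 2 = j by omega]
    push_cast
    ring
  · subst hj
    rw [bandWalkSum_odd j, if_neg (by rw [Nat.not_even_iff_odd]; exact ⟨j, rfl⟩)]
    push_cast
    ring

/-- **Even band moments for every `j`** (`2j < L`): `Σ_k (cos p₁ + cos p₂)^{2j} = L² · C(2j,j)² / 4^j` — the unrestricted form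
of `sum_cosSum_pow_even`. [cite: GradshteynRyzhik2015, 1.320.5] -/
theorem sum_cosSum_pow_two_mul (j : ℕ) (hL : 2 * j < L) :
    ∑ k : TorusSite 2 L, (∑ i, Real.cos (latticeMomentum L k i)) ^ (2 * j) =
      (L : ℝ) ^ 2 * (((2 * j).choose j : ℕ) : ℝ) ^ 2 / 4 ^ j := by
  rw [sum_cosSum_pow (2 * j) hL, bandWalkSum_eq_all j, pow_mul]
  norm_num

end LangerMattis

end Literature.MathematicalPhysics.QuantumLattice
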